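import Literature.NumberTheory.EllipticCurves.IwasawaAlgebraGenericTwistFiniteProofs
import Literature.NumberTheory.EllipticCurves.IwasawaSelmerTorsionProofs
import Literature.NumberTheory.EllipticCurves.CharacterModuleQuotientDualityProofs
import Literature.NumberTheory.IwasawaTheory.Greenberg2006.CofiniteGenerationCriterion
import HarnessLib

/-!
# Crux 4 `BSDpOnCellC` (stmt-BirchSwinnertonDyer-19034), line `telescope`, leaf N3′ `stub_memberControlMod` — the MEMBER fixed-part
# finiteness at the decomposition index (`(A₂[X − x_k])^G` finite, the `hfin𝔮`/`hfinK` input of the control theorems at `c = X − x_k`)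
# holds for ALL BUT FINITELY MANY `k` as soon as the WEIGHT-TWO fixed part `(A₂[X])^G` is finite
# (helper, `--supports stmt-BirchSwinnertonDyer-19034 --as helper`; closes nothing)

Cell `bsd-eis`, width seat `bsd-line-x2-p2` (prover g21, 2026-08-30; D-0154 KEY row 5). THEOREMS ONLY: no definition, no named fact,
no `sorry`, no instance, no notation. Companion of `…TelescopeK2InertiaDefectGenericFibre` (inertia side): the DECOMPOSITION-index input of
member control (p751755 `…ControlOfFrobeniusData` at `c = X − C x_k`: `hfin𝔮 = Set.Finite {a | c•a = 0 ∧ ∀ τ ∈ G, ρ₂ τ a = a}`) is GENERIC in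
`k`: writing `M = A₂^G` (invariants of any family of `Λ`-linear endomorphisms, `Λ = ℤ_p⟦X⟧`) with finitely generated dual `M^∨`,
* §1 **`isTorsion_characterModule_of_finite_torsionBy`** — `M[X]` finite ⇒ `M^∨` is `Λ`-TORSION (`(M[X])^⊥ = X·M^∨` by the injectivity
  of `ℚ/ℤ`, so `#M[X] • M^∨ ⊆ X • M^∨`; Greenberg's exercise LNM 1716 p. 61, tree `isTorsion_of_forall_nsmul_eq_X_smul`);
* §2 **`finite_torsionBy_of_finite_quotient_characterModule`** — `M^∨/θ·M^∨` finite ⇒ `M[θ]` finite (`(M[θ])^∨` is a quotient of it);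
* §3 **`finite_setOf_not_finite_torsionBy`** — `A` cofinitely generated, `M ≤ A`, `M[X]` finite ⇒ `{c ∈ 𝔪 | M[X − C c] infinite}` finite
  (Greenberg LNM 1716 pp. 123–124 generic-twist finiteness for the torsion module `M^∨`:
  `IwasawaAlgebraGenericTwistFiniteProofs.finite_setOf_not_finite_quotient_X_sub_C`, then §2);
* §4 **`finite_setOf_not_finite_fixed_torsionBy`** — indexed/invariants form for `ρ₂`: from `Set.Finite {a | X•a = 0 ∧ ∀ i, g_i a = a}`
  (the weight-two input, e.g. x2-p2 g20's `TelescopeK2FixedTorsionFiniteMult.finite_fixed_torsionBy_local_of_mult` on Cell C at `𝔭bar`)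
  and `x` injective on `𝒦` with `‖x k‖ < 1`: `{k ∈ 𝒦 | Set.Infinite {a | (X − C x_k)•a = 0 ∧ ∀ i, g_i a = a}}` is finite.

CONSEQUENCE (planning datum, LEAD's act): the `𝔭bar`-side local input of N3′'s member control needs, at EVERY `k`, the Frobenius
eigenvalue on the unramified quotient of the member at `p` (not recorded by `OrdinaryFiltration`); for all but finitely many `k` it is a
THEOREM of the weight-two input already in the tree. With `…InertiaDefectGenericFibre` this makes BOTH local inputs of (ctrl_k) generic-k
theorems — the case for typing N3′'s member clause ∀ᶠk (memo #46 §4, STATUS l.6545). Nothing about any curve is asserted.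

HONEST FRAMING: module theory + Pontryagin duality; no registered stub, crux or summit statement is proved by this file; closes: none.

References: [GreenbergLNM1716] §1 p. 61 (the exercise), §4 pp. 117, 123–125; [Greenberg2006] §3 A; [Tate1966Bourbaki] §5 Lemma z.3.
-/

noncomputable section

-- D-0017: single-problem summit, the namespace repeats the problem name by design.
set_option linter.dupNamespace false
set_option autoImplicit false

open Literature.NumberTheory.EllipticCurves Literature.NumberTheory.EllipticCurves.IwasawaAlgebra
open Literature.NumberTheory.IwasawaTheory Literature.NumberTheory.IwasawaTheory.Greenberg2006
open scoped Pointwise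

namespace Summit.BirchSwinnertonDyer.BirchSwinnertonDyer.Theorems.TelescopeK2FixedTorsionGenericFibre

variable {p : ℕ} [Fact p.Prime]

/-! ## §1 `M[X]` finite ⇒ `M^∨` torsion -/

/-- **`#M[θ] • M^∨ ⊆ θ • M^∨`**: a character multiplied by the order of the group `M[θ] = ker(θ·)` (`Nat.card`, so `0` if infinite) kills
it, hence is of the form `ψ ∘ (θ·) = θ • ψ` (injectivity of `ℚ/ℤ`). [cite: Tate1966Bourbaki, §5 Lemma z.3] [cite: GreenbergLNM1716, §1 p. 61] -/
theorem exists_card_nsmul_eq_smul {Λ : Type*} [CommRing Λ] {M : Type*} [AddCommGroup M] [Module Λ M] (θ : Λ)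
    (χ : CharacterModule M) :
    ∃ ψ : CharacterModule M, Nat.card {m : M | θ • m = 0} • χ = θ • ψ := by
  classical
  have hcard : Nat.card {m : M | θ • m = 0} = Nat.card (Submodule.torsionBy Λ M θ) :=
    Nat.card_congr
      { toFun := fun x => ⟨x.1, (Submodule.mem_torsionBy_iff θ x.1).2 x.2⟩
        invFun := fun x => ⟨(x : M), (Submodule.mem_torsionBy_iff θ (x : M)).1 x.2⟩
        left_inv := fun x => rfl
        right_inv := fun x => rfl }
  set n : ℕ := Nat.card {m : M | θ • m = 0} with hn
  have hkill : ∀ s : M, θ • s = 0 → ((n : Λ) • χ) s = 0 := by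
    intro s hs
    have hns : n • s = 0 := by
      have := card_nsmul_eq_zero' (G := Submodule.torsionBy Λ M θ) (x := ⟨s, (Submodule.mem_torsionBy_iff θ s).2 hs⟩)
      rw [← hcard] at this
      exact congrArg Subtype.val this
    rw [CharacterModule.smul_apply, Nat.cast_smul_eq_nsmul, hns, map_zero]
  obtain ⟨ψ, hψ⟩ := PontryaginCard.exists_eq_smul_of_forall_ker (R := Λ) (X := CharacterModule M) (S := M)
    (AddMonoidHom.id _) Function.bijective_id θ (DistribSMul.toAddMonoidHom M θ) (fun x s => rfl) hkill
  refine ⟨ψ, ?_⟩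
  rw [← Nat.cast_smul_eq_nsmul Λ]
  exact hψ

/-- **`M[X]` finite ⇒ `M^∨` is `Λ`-torsion** (`Λ = ℤ_p⟦X⟧`, `M^∨` finitely generated): Greenberg's exercise «if `X/TX` is finite then `X`
is torsion» on the compact side, `(M[X])^∨ = M^∨/X·M^∨`. [cite: GreenbergLNM1716, §1 p. 61 (proof of Thm 1.4)] -/
theorem isTorsion_characterModule_of_finite_torsionBy {M : Type*} [AddCommGroup M] [Module (IwasawaAlgebra p) M]
    [Module.Finite (IwasawaAlgebra p) (CharacterModule M)]
    (hfin : Set.Finite {m : M | (PowerSeries.X : IwasawaAlgebra p) • m = 0}) :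
    Module.IsTorsion (IwasawaAlgebra p) (CharacterModule M) := by
  haveI : Finite {m : M | (PowerSeries.X : IwasawaAlgebra p) • m = 0} := hfin.to_subtype
  haveI : Nonempty {m : M | (PowerSeries.X : IwasawaAlgebra p) • m = 0} := ⟨⟨0, smul_zero _⟩⟩
  have hn : Nat.card {m : M | (PowerSeries.X : IwasawaAlgebra p) • m = 0} ≠ 0 := Nat.card_pos.ne'
  exact IwasawaDual.isTorsion_of_forall_nsmul_eq_X_smul hn fun χ => exists_card_nsmul_eq_smul _ χ

/-! ## §2 `M^∨/θ·M^∨` finite ⇒ `M[θ]` finite -/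

/-- **`M^∨/θ·M^∨` finite ⇒ `M[θ]` finite**: restriction `M^∨ ↠ (M[θ])^∨` kills `θ·M^∨`, so `(M[θ])^∨` is a quotient of `M^∨/θ·M^∨`, and a
group with finitely many characters is finite. [cite: Greenberg2006, §2 A (p. 348 L4–6)] [cite: GreenbergLNM1716, §4 p. 124] -/
theorem finite_torsionBy_of_finite_quotient_characterModule {Λ : Type*} [CommRing Λ] {M : Type*} [AddCommGroup M] [Module Λ M]
    (θ : Λ) [hfin : Finite (CharacterModule M ⧸ (Ideal.span {θ} • (⊤ : Submodule Λ (CharacterModule M))))] :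
    Set.Finite {m : M | θ • m = 0} := by
  classical
  let Mθ := Submodule.torsionBy Λ M θ
  let res : CharacterModule M →ₗ[Λ] CharacterModule Mθ := CharacterModule.dual Mθ.subtype
  have hres : Function.Surjective res := CharacterModule.dual_surjective_of_injective _ Mθ.injective_subtype
  have hle : (Ideal.span {θ} • (⊤ : Submodule Λ (CharacterModule M))) ≤ LinearMap.ker res := by
    rw [Submodule.ideal_span_singleton_smul]
    rintro _ ⟨χ, -, rfl⟩
    rw [LinearMap.mem_ker]
    change res (θ • χ) = 0
    rw [map_smul]
    refine CharacterModule.ext _ fun m => ?_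
    rw [CharacterModule.smul_apply]
    have hm : θ • (m : M) = 0 := (Submodule.mem_torsionBy_iff θ (m : M)).1 m.2
    have : θ • m = 0 := Subtype.ext hm
    rw [this, map_zero]
    rfl
  -- the induced surjection from the finite quotient
  let q : (CharacterModule M ⧸ (Ideal.span {θ} • (⊤ : Submodule Λ (CharacterModule M)))) →ₗ[Λ] CharacterModule Mθ :=
    Submodule.liftQ _ res hle
  have hq : Function.Surjective q := by
    intro y
    obtain ⟨χ, rfl⟩ := hres y
    exact ⟨Submodule.Quotient.mk χ, rfl⟩
  haveI : Finite (CharacterModule Mθ) := Finite.of_surjective q hq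
  haveI : Finite Mθ := PontryaginCard.finite_of_finite_characterModule Mθ
  exact (Set.finite_univ.image (fun x : Mθ => (x : M))).subset fun m hm =>
    ⟨⟨m, (Submodule.mem_torsionBy_iff θ m).2 hm⟩, Set.mem_univ _, rfl⟩

/-! ## §3 Generic finiteness of `M[θ_c]` from `M[X]` finite -/

/-- **`M[X − C c]` is finite for all but finitely many `c ∈ 𝔪_{ℤ_p}`** whenever `M[X]` is finite, for ANY submodule `M` of a cofinitely
generated discrete `ℤ_p⟦X⟧`-module `A` (§1: `M^∨` torsion; Greenberg's generic-twist finiteness of `M^∨/θ_c M^∨`; §2).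
[cite: GreenbergLNM1716, §1 p. 61 and §4 pp. 123–124] [cite: Greenberg2006, §3 A] -/
theorem finite_setOf_not_finite_torsionBy {A : Type} [AddCommGroup A] [Module (IwasawaAlgebra p) A]
    (hA : IsCofinitelyGenerated (IwasawaAlgebra p) A) (M : Submodule (IwasawaAlgebra p) A)
    (hX : Set.Finite {m : M | (PowerSeries.X : IwasawaAlgebra p) • m = 0}) :
    {c : ℤ_[p] | c ∈ IsLocalRing.maximalIdeal ℤ_[p] ∧
      ¬ Set.Finite {m : M | (PowerSeries.X - PowerSeries.C c : IwasawaAlgebra p) • m = 0}}.Finite := by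
  haveI : Module.Finite (IwasawaAlgebra p) (CharacterModule M) :=
    isCofinitelyGenerated_iff_module_finite_characterModule.1 (hA.submodule M)
  have htors : Module.IsTorsion (IwasawaAlgebra p) (CharacterModule M) := isTorsion_characterModule_of_finite_torsionBy hX
  refine (finite_setOf_not_finite_quotient_X_sub_C p (M := CharacterModule M) htors).subset ?_
  rintro c ⟨hc, hinf⟩
  refine ⟨hc, fun hfin => hinf ?_⟩
  haveI := hfin
  exact finite_torsionBy_of_finite_quotient_characterModule (M := M) (PowerSeries.X - PowerSeries.C c : IwasawaAlgebra p)

/-! ## §4 Indexed form for the invariants of `ρ₂` -/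

/-- **The member fixed parts are finite for all but finitely many `k`.** For a cofinitely generated discrete `ℤ_p⟦X⟧`-module `A`, any family
`g_i` of `ℤ_p⟦X⟧`-linear endomorphisms (e.g. `ρ₂(τ)` for `τ` in the decomposition group at `𝔭bar` with `κ τ = 1`), and member points `x_k`
(`‖x k‖ < 1`, injective on `𝒦`): if the WEIGHT-TWO fixed part `{a | X•a = 0 ∧ ∀ i, g_i a = a}` is finite, then
`{a | (X − C x_k)•a = 0 ∧ ∀ i, g_i a = a}` is finite for all but finitely many `k ∈ 𝒦` — the `hfin𝔮`/`hfinK` input of member control.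
[cite: GreenbergLNM1716, §1 p. 61 and §4 pp. 123–124] [cite: Greenberg2006, §3 A] -/
theorem finite_setOf_not_finite_fixed_torsionBy {A : Type} [AddCommGroup A] [Module (IwasawaAlgebra p) A]
    (hA : IsCofinitelyGenerated (IwasawaAlgebra p) A) {ι : Type*} (g : ι → (A →ₗ[IwasawaAlgebra p] A))
    (hX : Set.Finite {a : A | (PowerSeries.X : IwasawaAlgebra p) • a = 0 ∧ ∀ i, g i a = a})
    (x : ℕ → ℤ_[p]) (hx : ∀ k, ‖x k‖ < 1) (𝒦 : Set ℕ) (hinj : Set.InjOn x 𝒦) :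
    {k : ℕ | k ∈ 𝒦 ∧ ¬ Set.Finite {a : A | (PowerSeries.X - PowerSeries.C (x k) : IwasawaAlgebra p) • a = 0 ∧ ∀ i, g i a = a}}.Finite := by
  classical
  -- the invariants submodule `M`
  let M : Submodule (IwasawaAlgebra p) A := ⨅ i, LinearMap.ker (g i - LinearMap.id)
  have hmem : ∀ a : A, a ∈ M ↔ ∀ i, g i a = a := fun a => by
    simp only [M, Submodule.mem_iInf, LinearMap.mem_ker, LinearMap.sub_apply, LinearMap.id_apply, sub_eq_zero]
  -- transport of finiteness between `{m : M | θ•m = 0}` and `{a | θ•a = 0 ∧ a ∈ M}`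
  have htransfer : ∀ θ : IwasawaAlgebra p,
      Set.Finite {m : M | θ • m = 0} ↔ Set.Finite {a : A | θ • a = 0 ∧ ∀ i, g i a = a} := by
    intro θ
    constructor
    · intro h
      refine (h.image (fun m : M => (m : A))).subset ?_
      rintro a ⟨ha, hg⟩
      refine ⟨⟨a, (hmem a).2 hg⟩, ?_, rfl⟩
      exact Subtype.ext (by simpa using ha)
    · intro h
      refine Set.Finite.of_finite_image (f := fun m : M => (m : A)) (h.subset ?_) (Subtype.val_injective.injOn)
      rintro _ ⟨m, hm, rfl⟩
      exact ⟨by simpa using congrArg Subtype.val hm, (hmem m).1 m.2⟩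
  have hXM : Set.Finite {m : M | (PowerSeries.X : IwasawaAlgebra p) • m = 0} := (htransfer _).2 hX
  have hfin := finite_setOf_not_finite_torsionBy hA M hXM
  have himage : x '' {k : ℕ | k ∈ 𝒦 ∧ ¬ Set.Finite {a : A |
      (PowerSeries.X - PowerSeries.C (x k) : IwasawaAlgebra p) • a = 0 ∧ ∀ i, g i a = a}} ⊆
      {c : ℤ_[p] | c ∈ IsLocalRing.maximalIdeal ℤ_[p] ∧
        ¬ Set.Finite {m : M | (PowerSeries.X - PowerSeries.C c : IwasawaAlgebra p) • m = 0}} := by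
    rintro _ ⟨k, ⟨-, hk⟩, rfl⟩
    exact ⟨PadicInt.mem_nonunits.2 (hx k), fun h => hk ((htransfer _).1 h)⟩
  exact Set.Finite.of_finite_image (hfin.subset himage) (hinj.mono fun k hk => hk.1)

end Summit.BirchSwinnertonDyer.BirchSwinnertonDyer.Theorems.TelescopeK2FixedTorsionGenericFibre

end
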